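import Mathlib
import HarnessLib
import Literature.Analysis.PDE.DivFormLiouville
import Summits.NavierStokesRegularity.NavierStokesRegularity.Theorems.PoloidalWindowDoorPoloidalWindowRigidityDivFormLiouvilleAll

/-!
# Route `PoloidalWindowDoor`, crux K2 (stmt-NavierStokesRegularity-19708) — H5 addendum: the ONE-SIDED Liouville theorem for
# `div(a∇u) = 0` (the `TODO(general form)` of `Literature.Analysis.PDE.divFormLiouville`: solutions bounded on ONE side)

Seat ns-poloidal-K2-p3 g2.  Moser's proof (M4b `liouville_of_three_le`) uses only a LOWER bound on `u` (Harnack for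
`(u − inf u + ε)/ε`); this file records the one-sided statements: `liouville_of_bddBelow_three_le` (`n ≥ 3`), then all `n` by the
descent of `…DivFormLiouvilleAll` (`liouville_of_bddBelow`), and the bounded-above case by `u ↦ −u` (`liouville_of_bddAbove`).
[cite: Moser1961Harnack, Thm 1 and corollary (positive solutions are constant)]

WHAT THIS IS NOT: nothing NS-specific; a sharpening of the discharged fact, for future consumers.
-/

noncomputable section

open MeasureTheory Set Function Filter Topology Metric Module
open scoped Matrix ENNReal NNReal

-- the summit and its single sub-problem share the name (CONVENTIONS §1), as in every Theorems file
set_option linter.dupNamespace false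

namespace Summit.NavierStokesRegularity.NavierStokesRegularity.Theorems.PoloidalWindowDoorPoloidalWindowRigidityDivFormLiouvilleOneSided

open Summit.NavierStokesRegularity.NavierStokesRegularity.Theorems.PoloidalWindowDoorPoloidalWindowRigidityDivFormHarnack
open Summit.NavierStokesRegularity.NavierStokesRegularity.Theorems.PoloidalWindowDoorPoloidalWindowRigidityDivFormLiouvilleHigh
open Summit.NavierStokesRegularity.NavierStokesRegularity.Theorems.PoloidalWindowDoorPoloidalWindowRigidityDivFormDescent
open Summit.NavierStokesRegularity.NavierStokesRegularity.Theorems.PoloidalWindowDoorPoloidalWindowRigidityDivFormLiouvilleAll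

variable {n : ℕ}

/-- **One-sided Liouville, `n ≥ 3`**: an entire `C¹` weak solution of `div(a∇u) = 0` that is bounded BELOW is constant
(Moser 1961: Harnack for `w_ε = (u − inf u + ε)/ε ≥ 1`, `R → ∞`, `ε → 0`). -/
theorem liouville_of_bddBelow_three_le (hn : 3 ≤ n) (a : EuclideanSpace ℝ (Fin n) → Matrix (Fin n) (Fin n) ℝ) (lam Λ : ℝ)
    (hlam : 0 < lam) (hmeas : ∀ i j, Measurable fun y => a y i j) (hsymm : ∀ y, (a y).IsSymm)
    (hell : ∀ y (ξ : Fin n → ℝ), lam * (ξ ⬝ᵥ ξ) ≤ ξ ⬝ᵥ (a y *ᵥ ξ)) (hbd : ∀ y i j, |a y i j| ≤ Λ)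
    (u : EuclideanSpace ℝ (Fin n) → ℝ) (hu : ContDiff ℝ 1 u) (hbdd : BddBelow (range u))
    (hweak : ∀ η : EuclideanSpace ℝ (Fin n) → ℝ, ContDiff ℝ 1 η → HasCompactSupport η →
      ∫ y, ∑ i, ∑ j, a y i j * fderiv ℝ u y (EuclideanSpace.single i 1) *
        fderiv ℝ η y (EuclideanSpace.single j 1) = 0) (x y : EuclideanSpace ℝ (Fin n)) :
    u x = u y := by
  obtain ⟨C_H, hC0, hH⟩ := harnack_ball hn hlam Λ
  set m : ℝ := ⨅ z, u z with hm
  have hmle : ∀ z, m ≤ u z := fun z => ciInf_le hbdd z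
  -- every value equals the infimum
  suffices key : ∀ z, u z ≤ m by
    exact le_antisymm ((key x).trans (hmle y)) ((key y).trans (hmle x))
  intro z
  by_contra hzm
  rw [not_le] at hzm
  set c : ℝ := u z - m with hc
  have hcpos : 0 < c := by rw [hc]; linarith
  -- ε = δ = c / (4 (C_H + 1))
  set ε : ℝ := c / (4 * (C_H + 1)) with hε
  have hεpos : 0 < ε := by rw [hε]; positivity
  obtain ⟨z', hz'⟩ : ∃ z', u z' < m + ε := exists_lt_of_ciInf_lt (by rw [← hm]; linarith)
  -- the normalised solution `w = (u - m + ε)/ε ≥ 1`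
  set w : EuclideanSpace ℝ (Fin n) → ℝ := fun y => ε⁻¹ * (u y - m + ε) with hw
  have hw1 : ∀ y, 1 ≤ w y := fun y => by
    rw [hw]
    have := hmle y
    rw [le_inv_mul_iff₀' hεpos]; linarith
  have hwC : ContDiff ℝ 1 w := contDiff_const.mul ((hu.sub contDiff_const).add contDiff_const)
  have hdw : ∀ y v, fderiv ℝ w y v = ε⁻¹ * fderiv ℝ u y v := by
    intro y v
    have hud : DifferentiableAt ℝ u y := (hu.differentiable one_ne_zero) y
    have h1 : fderiv ℝ w y = ε⁻¹ • fderiv ℝ u y := by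
      rw [hw, fderiv_const_mul ((hud.sub_const m).add_const ε)]
      rw [fderiv_add_const, fderiv_sub_const]
    rw [h1]; rfl
  have hweak' : ∀ η : EuclideanSpace ℝ (Fin n) → ℝ, ContDiff ℝ 1 η → HasCompactSupport η →
      ∫ y, ∑ i, ∑ j, a y i j * fderiv ℝ w y (EuclideanSpace.single i 1) *
        fderiv ℝ η y (EuclideanSpace.single j 1) = 0 := by
    intro η hη hηc
    have hpt : ∀ y, ∑ i, ∑ j, a y i j * fderiv ℝ w y (EuclideanSpace.single i 1) *
        fderiv ℝ η y (EuclideanSpace.single j 1) = ε⁻¹ * ∑ i, ∑ j, a y i j * fderiv ℝ u y (EuclideanSpace.single i 1) *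
        fderiv ℝ η y (EuclideanSpace.single j 1) := by
      intro y
      simp only [hdw, Finset.mul_sum]
      exact Finset.sum_congr rfl fun i _ => Finset.sum_congr rfl fun j _ => by ring
    simp_rw [hpt]
    rw [integral_const_mul, hweak η hη hηc, mul_zero]
  -- Harnack on a ball containing `z` and `z'`
  set R : ℝ := max ‖z‖ ‖z'‖ + 1 with hR
  have hRpos : 0 < R := by rw [hR]; positivity
  have hzR : z ∈ closedBall (0 : EuclideanSpace ℝ (Fin n)) R := by
    rw [mem_closedBall, dist_zero_right, hR]; linarith [le_max_left ‖z‖ ‖z'‖]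
  have hz'R : z' ∈ closedBall (0 : EuclideanSpace ℝ (Fin n)) R := by
    rw [mem_closedBall, dist_zero_right, hR]; linarith [le_max_right ‖z‖ ‖z'‖]
  have hHz := hH a hmeas hsymm hell hbd w hwC hw1 hweak' 0 R hRpos z hzR z' hz'R
  -- unpack: `u z - m + ε ≤ C_H (u z' - m + ε) < C_H · 2ε`, contradiction with `c = u z - m = 4(C_H+1)ε`
  simp only [hw] at hHz
  have h1 : u z - m + ε ≤ C_H * (u z' - m + ε) := by
    have := mul_le_mul_of_nonneg_left hHz hεpos.le
    have e1 : ε * (ε⁻¹ * (u z - m + ε)) = u z - m + ε := by field_simp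
    have e2 : ε * (C_H * (ε⁻¹ * (u z' - m + ε))) = C_H * (u z' - m + ε) := by field_simp
    rwa [e1, e2] at this
  have h2 : u z' - m + ε < 2 * ε := by linarith
  have h3 : C_H * (u z' - m + ε) ≤ C_H * (2 * ε) := mul_le_mul_of_nonneg_left h2.le hC0
  have h4 : c = 4 * (C_H + 1) * ε := by rw [hε]; field_simp
  nlinarith


/-- **One-sided Liouville in every dimension** (bounded below): descent `ℝⁿ ↪ ℝⁿ⁺¹` as in `…DivFormLiouvilleAll`. -/
theorem liouville_of_bddBelow (n : ℕ) (a : EuclideanSpace ℝ (Fin n) → Matrix (Fin n) (Fin n) ℝ) (lam Λ : ℝ)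
    (hlam : 0 < lam) (hmeas : ∀ i j, Measurable fun y => a y i j) (hsymm : ∀ y, (a y).IsSymm)
    (hell : ∀ y (ξ : Fin n → ℝ), lam * (ξ ⬝ᵥ ξ) ≤ ξ ⬝ᵥ (a y *ᵥ ξ)) (hbd : ∀ y i j, |a y i j| ≤ Λ)
    (u : EuclideanSpace ℝ (Fin n) → ℝ) (hu : ContDiff ℝ 1 u) (hbdd : BddBelow (range u))
    (hweak : ∀ η : EuclideanSpace ℝ (Fin n) → ℝ, ContDiff ℝ 1 η → HasCompactSupport η →
      ∫ y, ∑ i, ∑ j, a y i j * fderiv ℝ u y (EuclideanSpace.single i 1) *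
        fderiv ℝ η y (EuclideanSpace.single j 1) = 0) (x y : EuclideanSpace ℝ (Fin n)) :
    u x = u y := by
  let P : ℕ → Prop := fun m => ∀ (a : EuclideanSpace ℝ (Fin m) → Matrix (Fin m) (Fin m) ℝ) (lam Λ : ℝ), 0 < lam →
      (∀ i j, Measurable fun y => a y i j) → (∀ y, (a y).IsSymm) →
      (∀ y (ξ : Fin m → ℝ), lam * (ξ ⬝ᵥ ξ) ≤ ξ ⬝ᵥ (a y *ᵥ ξ)) → (∀ y i j, |a y i j| ≤ Λ) →
      ∀ (u : EuclideanSpace ℝ (Fin m) → ℝ), ContDiff ℝ 1 u → BddBelow (range u) →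
        (∀ η : EuclideanSpace ℝ (Fin m) → ℝ, ContDiff ℝ 1 η → HasCompactSupport η →
          ∫ y, ∑ i, ∑ j, a y i j * fderiv ℝ u y (EuclideanSpace.single i 1) *
            fderiv ℝ η y (EuclideanSpace.single j 1) = 0) →
        ∀ x y, u x = u y
  -- descent for the one-sided class
  have hdesc : ∀ m, P (m + 1) → P m := by
    intro m hN a lam Λ hlam hmeas hsymm hell hbd u hu hbdd hweak x y
    obtain ⟨K, hK⟩ := hbdd
    have h := hN (liftCoeff a) (min lam 1) (max Λ 1) (lt_min hlam one_pos) (measurable_liftCoeff hmeas)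
      (isSymm_liftCoeff hsymm) (liftCoeff_elliptic hell) (abs_liftCoeff_le hbd) (fun z => u (proj m z))
      (contDiff_lift hu) ⟨K, by rintro _ ⟨z, rfl⟩; exact hK ⟨proj m z, rfl⟩⟩ (lift_weak hmeas hbd hu hweak)
      (emb m x) (emb m y)
    simpa using h
  have hP : ∀ k m : ℕ, 3 ≤ m + k → P m := by
    intro k
    induction k with
    | zero => intro m hm; exact fun a lam Λ hlam hmeas hsymm hell hbd u hu hbdd hweak x y =>
        liouville_of_bddBelow_three_le (by omega) a lam Λ hlam hmeas hsymm hell hbd u hu hbdd hweak x y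
    | succ k ih => intro m hm; exact hdesc m (ih (m + 1) (by omega))
  exact hP 3 n (by omega) a lam Λ hlam hmeas hsymm hell hbd u hu hbdd hweak x y

/-- **One-sided Liouville in every dimension** (bounded above): apply the bounded-below case to `−u`. -/
theorem liouville_of_bddAbove (n : ℕ) (a : EuclideanSpace ℝ (Fin n) → Matrix (Fin n) (Fin n) ℝ) (lam Λ : ℝ)
    (hlam : 0 < lam) (hmeas : ∀ i j, Measurable fun y => a y i j) (hsymm : ∀ y, (a y).IsSymm)
    (hell : ∀ y (ξ : Fin n → ℝ), lam * (ξ ⬝ᵥ ξ) ≤ ξ ⬝ᵥ (a y *ᵥ ξ)) (hbd : ∀ y i j, |a y i j| ≤ Λ)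
    (u : EuclideanSpace ℝ (Fin n) → ℝ) (hu : ContDiff ℝ 1 u) (hbdd : BddAbove (range u))
    (hweak : ∀ η : EuclideanSpace ℝ (Fin n) → ℝ, ContDiff ℝ 1 η → HasCompactSupport η →
      ∫ y, ∑ i, ∑ j, a y i j * fderiv ℝ u y (EuclideanSpace.single i 1) *
        fderiv ℝ η y (EuclideanSpace.single j 1) = 0) (x y : EuclideanSpace ℝ (Fin n)) :
    u x = u y := by
  obtain ⟨K, hK⟩ := hbdd
  have hneg : BddBelow (range fun z => -u z) := ⟨-K, by rintro _ ⟨z, rfl⟩; exact neg_le_neg (hK ⟨z, rfl⟩)⟩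
  have hweak' : ∀ η : EuclideanSpace ℝ (Fin n) → ℝ, ContDiff ℝ 1 η → HasCompactSupport η →
      ∫ y, ∑ i, ∑ j, a y i j * fderiv ℝ (fun z => -u z) y (EuclideanSpace.single i 1) *
        fderiv ℝ η y (EuclideanSpace.single j 1) = 0 := by
    intro η hη hηc
    have hpt : ∀ y, ∑ i, ∑ j, a y i j * fderiv ℝ (fun z => -u z) y (EuclideanSpace.single i 1) *
        fderiv ℝ η y (EuclideanSpace.single j 1) = -(∑ i, ∑ j, a y i j * fderiv ℝ u y (EuclideanSpace.single i 1) *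
        fderiv ℝ η y (EuclideanSpace.single j 1)) := by
      intro y
      rw [show (fun z => -u z) = -u from rfl, fderiv_neg]
      simp only [_root_.neg_apply, ← Finset.sum_neg_distrib]
      exact Finset.sum_congr rfl fun i _ => Finset.sum_congr rfl fun j _ => by ring
    simp_rw [hpt]
    rw [integral_neg, hweak η hη hηc, neg_zero]
  have h := liouville_of_bddBelow n a lam Λ hlam hmeas hsymm hell hbd (fun z => -u z) hu.neg hneg hweak' x y
  simpa using h

end Summit.NavierStokesRegularity.NavierStokesRegularity.Theorems.PoloidalWindowDoorPoloidalWindowRigidityDivFormLiouvilleOneSided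

end
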